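import Summits.ABC.IUTFork.Cor312LicenceOfMultiReach
import Summits.ABC.IUTFork.Cor312LicenceShallowRealLevels
import Summits.ABC.IUTFork.Cor312LicenceShallowMultiSlot
import Summits.ABC.IUTFork.Cor312ProvKIdeles
import Literature.IUT.LogVolume.UnitLogVolume
import Literature.IUT.LogVolume.UnitLogMaxNorm
import HarnessLib

/-!
# R-H ROUND 1 (D-0079 «local-height condition I06⋆», D-0107), candidate row 15 `slotreach` — the SLOT-REACH WINDOW `SlotReachWindow`
# (author abc-iut-lens-wuc-1) TYPED FOR THE TREE: the definition verbatim, its integer CELL in the column vocabulary of I06STAR-COLUMNS, and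
# its instance at the genuine `K`-level datum `Cor312Prov.pilotDataOfK D K`

Bookkeeping + arithmetic file of the abc-iut cell, rung LADDER-ABC:A2.RESCUE.H (plan/rescue/R-H/START-HERE.md v1.2+; RH-CANDIDATES.tsv v1.2 row 15;
typer = abc-iut-rh-typ-12 for pair 12 → row 15, k2 desk hand abc-iut-rp-d3, k1 of record abc-iut-rh-num-1). TAKES NO SIDE on [IUTchIII] Cor. 3.12
or on any author; `SlotReachWindow` is a HYPOTHESIS SHAPE (claim-tagged `def … : Prop`), never asserted and never a Literature fact; typed ≠ proved;
instantiated ≠ endorsed. TWO bookkeeping definitions (`SlotReachWindow` — abc-iut-lens-wuc-1's, signature BYTE-IDENTICAL to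
`HOME/staging/RH/lens-wuc-1/HStar-slotreach.lean` :38 sha16 b131cdee138fbe71, so that the k2 hand's glue cites ONE tree name — and its genuine-datum
instance `SlotReachWindowK`); everything else is integer/real arithmetic. NO k2 content here: the glue «`SlotReachWindow` ⟹ multi-reach ⟹ S_H»
(abc-iut-w5-d107 `Thm311.Real.licence_settingPrVolSharp_of_multiReach`) with its mover lemma is the k2 hand's PROOF-ONLY companion file.

ROW 15 (RH-CANDIDATES.tsv v1.2, writer abc-iut-rh-lead g0; informal statement verbatim): «SLOT-REACH WINDOW = the CLOSED FORM of w5-d107's MULTI-REACH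
hypothesis: at every bad w|p, label j=i+1, every choice of j donor slots x_0..x_i | p: floor((m_Theta(j,w) − A_w)/e_w) <= m_q(w)/e_w − B_w/e_w + sum_a
(ceil(A_{x_a}/e_{x_a}) − B_{x_a}/e_{x_a}), A_x <= r_in(x) (inner conductor), B_x >= r_out(x) (outer exponent); tame: clause_iff_tame PROVED (= licence
cell on uniformly tame fibres, DECLARED equivalence); deep: keeps exactly the cells the (Ind2) slot movers reach».

CONTENTS.
* §1 (abc-iut-lens-wuc-1, verbatim) `SlotReachWindow` + `clause_iff_tame` (uniformly tame fibre: the clause ⟺ abc-iut-w5-d180's integer window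
  `e·⌊(mΘ−1)/e⌋ + 1 − j·(e−1) ≤ mq`, `Cor312LicenceExplicitDepthExact.licence_settingDHVolSharp_iff_of_tame_orders_single`).
* §2 (typer) THE CELL IN INTEGER COLUMN CURRENCY: `clause_iff_uniform` — on a fibre with uniform certified data `(e, A, B)` the `(w, j)`-clause is
  `e·⌊(mΘ − A)/e⌋ ≤ mq − B + j·(e·⌈A/e⌉ − B)` (CARD-slotreach «uniform-fibre integer form»; `j = i+1`); `tameCell_iff_band` — abc-iut-w5-d180's tame
  window IS column 37 `licence_cell_tame` of I06STAR-COLUMNS v2.1, «(j²−1)·P ≤ j·(e−1) + ((j²·P − 1) mod e)»; `slotCell_of_i06Cell` — abc-iut-rp-d2's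
  I06⋆ sufficient cell in `w`-units «(j²−1)·mq ≤ e − A» IMPLIES the slot cell whenever `1 ≤ A`, `B ≤ A` (coverage/k4: H⋆ is weaker than I06⋆'s POS door).
* §3 (typer) THE GENUINE-DATUM INSTANCE `SlotReachWindowK D e n₀ lam mΘ mq` at `pilotDataOfK D K` (bad := `placeOf w ∈ S`; literally the `hH` binder of
  the k2 theorem at `X := pilotDataOfK D K`, `slotReachWindowK_iff`) and THE k1 EVALUATION LEMMA `slotReachWindowK_iff_cells_of_uniform`: for
  uniform per-prime data and the realising profile `mΘ = j²·mq` ([IUTchI] Ex. 3.2 (iv); `Cor312Prov.exists_nat_qPilot_pilotDataOfK`), H⋆ ⟺ every bad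
  cell's integer inequality — what abc-iut-rh-num-1 evaluates from columns `e_w`, `m_q = e_w·H/(2l)`, `j` and certified `(A, B)`.
[cite: Mochizuki2012, IUTchI Ex. 3.2 (iv) p. 71; IUTchIII Thm. 3.11 (i) (Ind2) p. 154, Step (xi-f) p. 184] [cite: DupuyHilado2025, §3.9, §4.9]
[cite: WeilBNT1967, Ch. II §2, Th. 1] [claim: Mochizuki2012, status: disputed] for every IUT locution. Axioms: standard.
-/

noncomputable section

open Set Function
open scoped Pointwise

namespace Summit.ABC.IUTFork.Repair.RHSlotReach

/-! ## §1. The slot-reach window (abc-iut-lens-wuc-1, verbatim) -/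

/-- **H⋆ (lens wuc, seat 1): the SLOT-REACH WINDOW.** Numeric data per prime `p` and place `x | p` of the fibre `Fib p`:
`e x` (absolute ramification index), `n₀ x ≤ r_in(x) := min{n : 𝔪_x^n ⊆ log_p(𝒪_x^×)}` (inner conductor, certified from BELOW by one
non-log-unit of valuation `≥ n₀ − 1`), `lam x ≤ log_p max‖log_p(𝒪_x^×)‖ = −r_out(x)/e_x` (outer radius, certified by one log-unit of norm `≥ p^{lam x}`), and at the bad places `w` the orders `mΘ i w`, `mq w` of the
Θ- and q-ideles in the uniformizer (`‖t_{Θ,i+1,w}‖ = ‖ϖ_w‖^{mΘ}`, `‖t_{q,w}‖ = ‖ϖ_w‖^{mq}`; realising ideles: `mΘ i w = (i+1)²·mq w`).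
THE WINDOW at the bad place `w`, label `j = i+1`, donor slots `x₀,…,x_i | p` (integer division = floor, `e > 0`):
  `⌊(mΘ − n₀(w))/e_w⌋ ≤ mq/e_w + λ_w + Σ_{a ≤ i} (λ_{x_a} + ⌈n₀(x_a)/e_{x_a}⌉)`.
At a uniformly TAME fibre (`p > 2`, `e ≤ p−2`: `n₀ = 1`, `λ = −1/e`) this is EXACTLY abc-iut-w5-d180's decided window
`e·⌊(mΘ−1)/e⌋ + 1 − j·(e−1) ≤ mq` (`licence_settingDHVolSharp_iff_of_tame_orders_single`). Hypothesis shape only; never asserted.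
(Definition authored by abc-iut-lens-wuc-1, R-H round 1 row 15; filed verbatim by the row's typer.)
[cite: DupuyHilado2025, §3.9, §4.9] [cite: WeilBNT1967, Ch. II §2, Th. 1] [claim: Mochizuki2012, status: disputed] -/
@[claim "Mochizuki2012" "disputed"]
def SlotReachWindow (lstar : ℕ) (Fib : Nat.Primes → Type) (bad : ∀ pp, Fib pp → Prop)
    (e n₀ : ∀ pp, Fib pp → ℕ) (lam : ∀ pp, Fib pp → ℝ)
    (mΘ : ∀ pp, Fin lstar → Fib pp → ℤ) (mq : ∀ pp, Fib pp → ℤ) : Prop :=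
  ∀ (pp : Nat.Primes) (i : Fin lstar) (w : Fib pp), bad pp w →
    ∀ x : Fin ((i : ℕ) + 1) → Fib pp,
      (((mΘ pp i w - n₀ pp w) / (e pp w : ℤ) : ℤ) : ℝ)
        ≤ (mq pp w : ℝ) / (e pp w : ℝ) + lam pp w
          + ∑ a, (lam pp (x a) + ((-((-(n₀ pp (x a) : ℤ)) / (e pp (x a) : ℤ)) : ℤ) : ℝ))

/-- Integer-division sanity (Lean's `/` on `ℤ` is Euclidean = floor for a positive divisor): `⌊−1/3⌋ = −1`, `⌈1/3⌉ = −⌊−1/3⌋ = 1`. -/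
example : ((-1 : ℤ) / 3 = -1) ∧ (-((-1 : ℤ) / 3) = 1) := by decide

/-- **Tame specialisation (one clause)** (abc-iut-lens-wuc-1). With `n₀ = 1`, `λ = −1/e` at every place over `p` (uniformly tame fibre) the
`(w, i)`-clause of `SlotReachWindow` is abc-iut-w5-d180's integer window `e·⌊(mΘ−1)/e⌋ + 1 − (i+1)·(e−1) ≤ mq`. [folklore] -/
theorem clause_iff_tame (e : ℕ) (he : 1 ≤ e) (i : ℕ) (MΘ Mq : ℤ) :
    ((((MΘ - 1) / (e : ℤ) : ℤ) : ℝ) ≤ (Mq : ℝ) / (e : ℝ) + (-(1 : ℝ) / e)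
        + ∑ _a : Fin (i + 1), ((-(1 : ℝ) / e) + ((-((-(1 : ℤ)) / (e : ℤ)) : ℤ) : ℝ)))
      ↔ (e : ℤ) * ((MΘ - 1) / e) + 1 - ((i + 1 : ℕ) : ℤ) * ((e : ℤ) - 1) ≤ Mq := by
  have he0 : (0 : ℝ) < e := by exact_mod_cast he
  have hdiv : (-1 : ℤ) / (e : ℤ) = -1 := by
    have h := (Int.ediv_emod_unique (a := -1) (b := (e : ℤ)) (r := (e : ℤ) - 1) (q := -1)
      (by exact_mod_cast he)).2 ⟨by ring, by omega, by omega⟩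
    exact h.1
  have hsum : ∑ _a : Fin (i + 1), ((-(1 : ℝ) / e) + ((-((-(1 : ℤ)) / (e : ℤ)) : ℤ) : ℝ))
      = ((i : ℝ) + 1) * (1 - 1 / e) := by
    rw [Finset.sum_const, Finset.card_univ, Fintype.card_fin, nsmul_eq_mul, hdiv]
    push_cast
    ring
  rw [hsum]
  have key : (Mq : ℝ) / (e : ℝ) + -(1 : ℝ) / e + ((i : ℝ) + 1) * (1 - 1 / e)
      = ((Mq - 1 + ((i : ℤ) + 1) * ((e : ℤ) - 1) : ℤ) : ℝ) / e := by
    push_cast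
    field_simp
    ring
  rw [key, le_div_iff₀ he0,
    show (((MΘ - 1) / (e : ℤ) : ℤ) : ℝ) * (e : ℝ) = (((e : ℤ) * ((MΘ - 1) / (e : ℤ)) : ℤ) : ℝ) by push_cast; ring,
    Int.cast_le]
  push_cast
  constructor
  · intro h; linarith
  · intro h; linarith

/-! ## §2. The cell in the integer column currency of I06STAR-COLUMNS (typer) -/

/-- **UNIFORM-FIBRE INTEGER CELL** (CARD-slotreach «uniform-fibre integer form»): with the same certified data at every place over `p` —
ramification `e ≥ 1`, inner conductor bound `A`, outer exponent `B` (`λ = −B/e`) — the `(w, i)`-clause of `SlotReachWindow` reads, in `𝔪_w`-units,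
`e·⌊(mΘ − A)/e⌋ ≤ mq − B + (i+1)·(e·⌈A/e⌉ − B)` (`⌈A/e⌉ = −⌊−A/e⌋`). At `(A, B) = (1, 1)` this is `clause_iff_tame`. [folklore] -/
theorem clause_iff_uniform (e : ℕ) (he : 1 ≤ e) (A : ℕ) (B : ℤ) (i : ℕ) (MΘ Mq : ℤ) :
    ((((MΘ - A) / (e : ℤ) : ℤ) : ℝ) ≤ (Mq : ℝ) / (e : ℝ) + (-(B : ℝ) / e)
        + ∑ _a : Fin (i + 1), ((-(B : ℝ) / e) + ((-((-(A : ℤ)) / (e : ℤ)) : ℤ) : ℝ)))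
      ↔ (e : ℤ) * ((MΘ - A) / (e : ℤ)) ≤ Mq - B + ((i + 1 : ℕ) : ℤ) * ((e : ℤ) * (-((-(A : ℤ)) / (e : ℤ))) - B) := by
  have he0 : (0 : ℝ) < e := by exact_mod_cast he
  generalize hC : (-((-(A : ℤ)) / (e : ℤ)) : ℤ) = C
  have hsum : ∑ _a : Fin (i + 1), ((-(B : ℝ) / e) + ((C : ℤ) : ℝ)) = ((i : ℝ) + 1) * (-(B : ℝ) / e + (C : ℝ)) := by
    rw [Finset.sum_const, Finset.card_univ, Fintype.card_fin, nsmul_eq_mul]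
    push_cast
    ring
  rw [hsum]
  have key : (Mq : ℝ) / (e : ℝ) + -(B : ℝ) / e + ((i : ℝ) + 1) * (-(B : ℝ) / e + (C : ℝ))
      = ((Mq - B + ((i : ℤ) + 1) * ((e : ℤ) * C - B) : ℤ) : ℝ) / e := by
    push_cast
    field_simp
    ring
  rw [key, le_div_iff₀ he0,
    show (((MΘ - A) / (e : ℤ) : ℤ) : ℝ) * (e : ℝ) = (((e : ℤ) * ((MΘ - A) / (e : ℤ)) : ℤ) : ℝ) by push_cast; ring,
    Int.cast_le]
  push_cast
  constructor
  · intro h; linarith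
  · intro h; linarith

/-- **abc-iut-w5-d180's TAME WINDOW IS COLUMN 37 `licence_cell_tame`** of I06STAR-COLUMNS v2.1 (abc-iut-rp-cx RH-CEILING-TAME recipe, p448597 form):
`e·⌊(j²·P − 1)/e⌋ + 1 − j·(e − 1) ≤ P ⟺ (j² − 1)·P ≤ j·(e − 1) + ((j²·P − 1) mod e)`. [folklore] -/
theorem tameCell_iff_band (e : ℤ) (j P : ℤ) :
    e * ((j ^ 2 * P - 1) / e) + 1 - j * (e - 1) ≤ P ↔ (j ^ 2 - 1) * P ≤ j * (e - 1) + (j ^ 2 * P - 1) % e := by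
  have h := Int.mul_ediv_add_emod (j ^ 2 * P - 1) e
  constructor
  · intro h'; linarith
  · intro h'; linarith

/-- `e·⌊x/e⌋ ≤ x` for `e ≥ 1` (Euclidean division). [folklore] -/
theorem mul_ediv_le_self {e : ℤ} (he : 1 ≤ e) (x : ℤ) : e * (x / e) ≤ x := by
  have h := Int.mul_ediv_add_emod x e
  have h0 := Int.emod_nonneg x (show e ≠ 0 by omega)
  linarith

/-- `A ≤ e·⌈A/e⌉` with `⌈A/e⌉ = −⌊−A/e⌋`, for `e ≥ 1`. [folklore] -/
theorem le_mul_ceilDiv {e : ℤ} (he : 1 ≤ e) (A : ℤ) : A ≤ e * (-((-A) / e)) := by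
  have h := mul_ediv_le_self he (-A)
  linarith

/-- **COVERAGE / k4 direction: abc-iut-rp-d2's I06⋆ SUFFICIENT CELL IMPLIES THE SLOT CELL.** In `𝔪_w`-units, with `e ≥ 1`, `1 ≤ A`, `B ≤ A`
(outer exponent at most the inner conductor bound — automatic for exact `(r_in, r_out)`), `1 ≤ j`: the I06⋆ POS door «`(j²−1)·mq ≤ e − A`»
(START-HERE §1 `κ⁻`-reading in `w`-units, abc-iut-rp-d2 15:21:27Z (R-a)) gives `e·⌊(j²·mq − A)/e⌋ ≤ mq − B + j·(e·⌈A/e⌉ − B)`. [folklore] -/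
theorem slotCell_of_i06Cell {e A B j mq : ℤ} (he : 1 ≤ e) (hA : 1 ≤ A) (hBA : B ≤ A) (hj : 1 ≤ j)
    (hi06 : (j ^ 2 - 1) * mq ≤ e - A) :
    e * ((j ^ 2 * mq - A) / e) ≤ mq - B + j * (e * (-((-A) / e)) - B) := by
  have h1 := mul_ediv_le_self he (j ^ 2 * mq - A)
  have h2 := le_mul_ceilDiv he A
  -- `e·⌈A/e⌉ ≥ e` since `⌈A/e⌉ ≥ 1`
  have hC1 : 1 ≤ -((-A) / e) := by
    by_contra hlt
    rw [not_le] at hlt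
    have : e * (-((-A) / e)) ≤ 0 := by nlinarith
    linarith
  have h3 : e ≤ e * (-((-A) / e)) := by nlinarith
  have h4 : (j - 1) * A ≤ (j - 1) * (e * (-((-A) / e))) := mul_le_mul_of_nonneg_left h2 (by linarith)
  nlinarith

/-! ## §3. The instance at the genuine `K`-level datum `pilotDataOfK D K` and the k1 evaluation lemma (typer) -/

section Genuine

open NumberField IsDedekindDomain Literature.IUT.HodgeTheaters Summit.ABC.IUTFork.Thm311 Summit.ABC.IUTFork.Thm311.Real
  Summit.ABC.IUTFork.Cor312 Summit.ABC.IUTFork.Cor312Prov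

variable {F K Fbar : Type} [Field F] [NumberField F] [Field K] [NumberField K] [Algebra F K] [Field Fbar]
  [Algebra F Fbar] [Algebra K Fbar] {E : WeierstrassCurve F} [E.IsElliptic] {l : ℕ} {Pb : BadPlacePredicates K}
  (D : InitialThetaData F K Fbar E l Pb)

/-- **ROW 15 AT THE GENUINE `K`-LEVEL DATUM**: `SlotReachWindow` over the packets of `Cor312Prov.pilotDataOfK D K` — fibres `x ∣ p` of `K`, bad :=
«`placeOf x ∈ S`» (the primes of `K` over `𝕍(F)^bad`, abc-iut-C-cert-3 `mem_pilotDataOfK_S_iff`), labels `Fin l⋆` — with numeric dictionary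
`(e, n₀, lam, mΘ, mq)`. This is LITERALLY the `hH` binder of the k2 glue «H⋆ ⟹ ∃ ρ qK, QPinned ∧ PilotKummerCompatHull at
`Thm311.Real.settingPrVolSharp (pilotDataOfK D K) …`» (door (a), movers) at `X := pilotDataOfK D K`. [R-H candidate, hypothesis — not a fact]
[claim: Mochizuki2012, status: disputed] -/
@[claim "Mochizuki2012" "disputed"]
def SlotReachWindowK (e n₀ : ∀ pp : Nat.Primes, (thetaIndex (pilotDataOfK D K)).Fibre (.inr pp) → ℕ)
    (lam : ∀ pp : Nat.Primes, (thetaIndex (pilotDataOfK D K)).Fibre (.inr pp) → ℝ)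
    (mΘ : ∀ pp : Nat.Primes, Fin (thetaIndex (pilotDataOfK D K)).lstar → (thetaIndex (pilotDataOfK D K)).Fibre (.inr pp) → ℤ)
    (mq : ∀ pp : Nat.Primes, (thetaIndex (pilotDataOfK D K)).Fibre (.inr pp) → ℤ) : Prop :=
  SlotReachWindow (thetaIndex (pilotDataOfK D K)).lstar (fun pp => (thetaIndex (pilotDataOfK D K)).Fibre (.inr pp))
    (fun pp w => haveI : Fact (pp : ℕ).Prime := ⟨pp.2⟩; placeOf (pilotDataOfK D K) pp.1 w ∈ (pilotDataOfK D K).S) e n₀ lam mΘ mq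

/-- `SlotReachWindowK` unfolds to the k2 theorem's `hH` binder at `X := pilotDataOfK D K`. [folklore] -/
theorem slotReachWindowK_iff (e n₀ : ∀ pp : Nat.Primes, (thetaIndex (pilotDataOfK D K)).Fibre (.inr pp) → ℕ)
    (lam : ∀ pp : Nat.Primes, (thetaIndex (pilotDataOfK D K)).Fibre (.inr pp) → ℝ)
    (mΘ : ∀ pp : Nat.Primes, Fin (thetaIndex (pilotDataOfK D K)).lstar → (thetaIndex (pilotDataOfK D K)).Fibre (.inr pp) → ℤ)
    (mq : ∀ pp : Nat.Primes, (thetaIndex (pilotDataOfK D K)).Fibre (.inr pp) → ℤ) :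
    SlotReachWindowK D e n₀ lam mΘ mq ↔
      SlotReachWindow (thetaIndex (pilotDataOfK D K)).lstar (fun pp => (thetaIndex (pilotDataOfK D K)).Fibre (.inr pp))
        (fun pp w => haveI : Fact (pp : ℕ).Prime := ⟨pp.2⟩; placeOf (pilotDataOfK D K) pp.1 w ∈ (pilotDataOfK D K).S) e n₀ lam mΘ mq :=
  Iff.rfl

/-- **k1 EVALUATION LEMMA (uniform fibres, realising profile).** If over every prime `p` the certified data are uniform on the fibre —
`e x = e_p ≥ 1`, `n₀ x = A_p`, `lam x = −B_p/e_p` for all `x ∣ p` (e.g. `K/ℚ` Galois: every HEX / G-HEX row) — and the Θ-orders follow the realising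
profile `mΘ(j, w) = j²·mq(w)` ([IUTchI] Ex. 3.2 (iv)), then ROW 15 at the genuine datum HOLDS IFF at every bad place `w ∣ p` and every label `j = i+1`:
`e_p·⌊(j²·mq(w) − A_p)/e_p⌋ ≤ mq(w) − B_p + j·(e_p·⌈A_p/e_p⌉ − B_p)` — the integer cell abc-iut-rh-num-1 evaluates from the columns
(`e_w`, `m_q = e_w·H/(2l)`, `j`, certified `(A, B)`); the donor choice is immaterial on a uniform fibre. [cite: Mochizuki2012, IUTchI Ex. 3.2 (iv) p. 71]
[claim: Mochizuki2012, status: disputed] -/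
theorem slotReachWindowK_iff_cells_of_uniform (eK AK : Nat.Primes → ℕ) (BK : Nat.Primes → ℤ) (heK : ∀ pp, 1 ≤ eK pp)
    (e n₀ : ∀ pp : Nat.Primes, (thetaIndex (pilotDataOfK D K)).Fibre (.inr pp) → ℕ)
    (lam : ∀ pp : Nat.Primes, (thetaIndex (pilotDataOfK D K)).Fibre (.inr pp) → ℝ)
    (mΘ : ∀ pp : Nat.Primes, Fin (thetaIndex (pilotDataOfK D K)).lstar → (thetaIndex (pilotDataOfK D K)).Fibre (.inr pp) → ℤ)
    (mq : ∀ pp : Nat.Primes, (thetaIndex (pilotDataOfK D K)).Fibre (.inr pp) → ℤ)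
    (he : ∀ pp x, e pp x = eK pp) (hn₀ : ∀ pp x, n₀ pp x = AK pp)
    (hlam : ∀ pp x, lam pp x = -((BK pp : ℤ) : ℝ) / ((eK pp : ℕ) : ℝ))
    (hmΘ : ∀ pp i w, mΘ pp i w = ((((i : ℕ) : ℤ) + 1) ^ 2) * mq pp w) :
    SlotReachWindowK D e n₀ lam mΘ mq ↔
      ∀ (pp : Nat.Primes) (i : Fin (thetaIndex (pilotDataOfK D K)).lstar) (w : (thetaIndex (pilotDataOfK D K)).Fibre (.inr pp)),
        (haveI : Fact (pp : ℕ).Prime := ⟨pp.2⟩; placeOf (pilotDataOfK D K) pp.1 w ∈ (pilotDataOfK D K).S) →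
          (eK pp : ℤ) * ((((((i : ℕ) : ℤ) + 1) ^ 2) * mq pp w - AK pp) / (eK pp : ℤ)) ≤
            mq pp w - BK pp + (((i : ℕ) + 1 : ℕ) : ℤ) * ((eK pp : ℤ) * (-((-(AK pp : ℤ)) / (eK pp : ℤ))) - BK pp) := by
  unfold SlotReachWindowK SlotReachWindow
  refine forall_congr' fun pp => forall_congr' fun i => forall_congr' fun w => forall_congr' fun _ => ?_
  simp only [he, hn₀, hlam, hmΘ]
  rw [← clause_iff_uniform (eK pp) (heK pp) (AK pp) (BK pp) (i : ℕ) _ (mq pp w)]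
  exact ⟨fun h => h fun _ => w, fun h _ => h⟩

end Genuine

end Summit.ABC.IUTFork.Repair.RHSlotReach


/-! ## §4. (APPENDED 2026-08-26, typer) `A = 1` IS ALWAYS CERTIFIED: an integral non-member of `log_p(𝒪^×)` exists at every place

The k2 theorem's binder `hsharp` («`∃ u, ‖u‖ ≤ ‖ϖ_x‖^{n₀(x) − 1} ∧ u ∉ log_p(𝒪_x^×)`», the certificate that `n₀(x) = A_x ≤ r_in(x)`) is
discharged at `n₀ = 1` for EVERY `p`-adic field, wild and dyadic places included: by [IUTchIV] Prop. 1.4 (ii) (campaign-S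
`Literature.IUT.LogVolume.localVolume_real_logUnits_eq_inv_pow`: `μ(log_p(𝒪^×)) = p^{−(f+m)} < 1 = μ(𝒪)`) the unit ball is not contained in
`log_p(𝒪^×)`. Hence the k1 reading `(A, B) = (1, r_out♯)` of the column block is kernel-certified on the `A`-side (the `B`-side is the member
`log_p(1+ϖ)` of valuation `r_out♯ = min_t (p^t − t·e)` when untied, abc-iut-rp-x2 `CandInternal2RealSharp`). -/

namespace Summit.ABC.IUTFork.Repair.RHSlotReach

section NonMember

open MeasureTheory Metric Literature.IUT.LogVolume

variable (p : ℕ) [Fact p.Prime] (K : Type*) [NontriviallyNormedField K] [instK : NormedAlgebra ℚ_[p] K] [IsUltrametricDist K]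
  [ProperSpace K]

include instK in
/-- **An integral NON-member of `log_p(𝒪_K^×)` exists** in every `p`-adic field `K`: `∃ u, ‖u‖ ≤ 1 ∧ u ∉ log_p(𝒪_K^×)` — since
`μ(log_p(𝒪_K^×)) = p^{−(f+m)} < 1 = μ(𝒪_K)` ([IUTchIV] Prop. 1.4 (ii), `localVolume_real_logUnits_eq_inv_pow`), the unit ball is not inside the
compact set `log_p(𝒪_K^×)`. [cite: Mochizuki2012, IUTchIV Prop. 1.4 (ii) p. 13] -/
theorem exists_norm_le_one_not_mem_logUnits : ∃ u : K, ‖u‖ ≤ 1 ∧ u ∉ logUnits K := by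
  borelize K
  by_contra h
  have hsub : closedBall (0 : K) 1 ⊆ logUnits K := by
    intro u hu
    by_contra hu'
    exact h ⟨u, mem_closedBall_zero_iff.1 hu, hu'⟩
  have hfin : localVolume K (logUnits K) ≠ ⊤ := (isCompact_logUnits p K).measure_lt_top.ne
  have hmono : localVolume K (closedBall (0 : K) 1) ≤ localVolume K (logUnits K) := measure_mono hsub
  rw [localVolume_closedBall_one] at hmono
  have h1 : (1 : ℝ) ≤ (localVolume K (logUnits K)).toReal := by
    have := ENNReal.toReal_mono hfin hmono
    simpa using this
  rw [localVolume_real_logUnits_eq_inv_pow p K] at h1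
  have hp1 : (1 : ℝ) < p := by exact_mod_cast (Fact.out : p.Prime).one_lt
  have hf : residueDegree p K + torsionPExp p K ≠ 0 := by
    have := residueDegree_pos p K
    omega
  have hpow : (1 : ℝ) < (p : ℝ) ^ (residueDegree p K + torsionPExp p K) := one_lt_pow₀ hp1 hf
  have hlt : ((p : ℝ) ^ (residueDegree p K + torsionPExp p K))⁻¹ < 1 := inv_lt_one_of_one_lt₀ hpow
  linarith

include instK in
/-- **The `hsharp` certificate at `n₀ = 1`** (literal binder shape of the k2 glue, exponent `(1 : ℕ) − 1 = 0`): for every `ϖ`,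
`∃ u, ‖u‖ ≤ ‖ϖ‖^{(1:ℤ)−1} ∧ u ∉ log_p(𝒪_K^×)`. So the slot-reach window with `A_x = 1` at every place rides a discharged inner certificate.
[cite: Mochizuki2012, IUTchIV Prop. 1.4 (ii) p. 13] -/
theorem exists_hsharp_one (ϖ : K) : ∃ u : K, ‖u‖ ≤ ‖ϖ‖ ^ (((1 : ℕ) : ℤ) - 1) ∧ u ∉ logUnits K := by
  obtain ⟨u, hu, hu'⟩ := exists_norm_le_one_not_mem_logUnits p K
  refine ⟨u, ?_, hu'⟩
  have h0 : (((1 : ℕ) : ℤ) - 1) = 0 := by norm_num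
  rw [h0, zpow_zero]
  exact hu

end NonMember

end Summit.ABC.IUTFork.Repair.RHSlotReach


/-! ## §5. (APPENDED 2026-08-26, typer) `B = r_out♯` IS CERTIFIED WHEN UNTIED: the outer-radius binder `hrad` at `λ = −r_out♯/e`

The k2 theorem's binder `hrad` («`∃ z ∈ log_p(𝒪_x^×), p^{λ_x} ≤ ‖z‖`») at the column value `λ_x = −r_out♯(x)/e_x`,
`r_out♯ = p^{a₀} − a₀·e` (`a₀` the STRICT turning point: `p^a(p−1) < e` for `a < a₀`, `e < p^{a₀}(p−1)`; column 32 of I06STAR-COLUMNS without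
the `(tie)` flag) is DISCHARGED by the member `log_p(1 + ϖ_x)`, whose norm is exactly `‖ϖ_x‖^{r_out♯}` (campaign-S / abc-iut-rp-x2 lineage
`Literature.IUT.LogVolume.LogEnvelope.exists_mem_logUnits_norm_eq_envelope`). With §4 this makes the k1 reading `(A, B) = (1, r_out♯)` of row 15
kernel-certified on BOTH sides at every untied place; only the mover lemma (k2) stands between a POS cell and the licence cell. -/

namespace Summit.ABC.IUTFork.Repair.RHSlotReach

section OuterRadius

open Metric Literature.IUT.LogVolume Literature.NumberTheory.GaloisRepresentations.Ultrametric

variable (p : ℕ) [Fact p.Prime] (K : Type*) [NontriviallyNormedField K] [instK : NormedAlgebra ℚ_[p] K] [IsUltrametricDist K]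
  [ProperSpace K]

include instK in
/-- **The `hrad` certificate at `λ = −r_out♯/e`** (untied turning point `a₀`): `∃ z ∈ log_p(𝒪_K^×), p^{−(p^{a₀} − e·a₀)/e} ≤ ‖z‖` — the member
`z = log_p(1 + ϖ)` attains it (`LogEnvelope.exists_mem_logUnits_norm_eq_envelope`, `‖ϖ‖ = p^{−1/e}`). [cite: NeukirchANT1999, Ch. II (5.5)] -/
theorem exists_hrad_sharp {ϖ : Kˣ} (hϖ : IsUniformizer ϖ) {a₀ : ℕ}
    (hlo : ∀ a < a₀, (p : ℤ) ^ a * ((p : ℤ) - 1) < absRamificationIdx p K)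
    (hhi : (absRamificationIdx p K : ℤ) < (p : ℤ) ^ a₀ * ((p : ℤ) - 1)) :
    ∃ z ∈ logUnits K,
      (p : ℝ) ^ (-((((p : ℤ) ^ a₀ - (absRamificationIdx p K : ℤ) * (a₀ : ℤ) : ℤ) : ℝ)) / (absRamificationIdx p K : ℝ)) ≤ ‖z‖ := by
  obtain ⟨z, hz, hzn⟩ := LogEnvelope.exists_mem_logUnits_norm_eq_envelope p hϖ hlo hhi
  refine ⟨z, hz, le_of_eq ?_⟩
  have hp0 : (0 : ℝ) ≤ p := by positivity
  have he0 : (absRamificationIdx p K : ℝ) ≠ 0 := by exact_mod_cast (absRamificationIdx_pos p K).ne'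
  rw [hzn, norm_eq_rpow_of_isUniformizer p K hϖ, ← Real.rpow_intCast, ← Real.rpow_mul hp0]
  congr 1
  field_simp

end OuterRadius

end Summit.ABC.IUTFork.Repair.RHSlotReach

end
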